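import Literature.Geometry.Symplectic.AlmostComplexStructure
import Literature.Geometry.Symplectic.JHolomorphicMap
import Literature.Geometry.Symplectic.JHolomorphicReparametrisation
import Literature.Geometry.Symplectic.JHolomorphicIntersectionDichotomy
import HarnessLib

/-!
# A `J`-sphere meets an embedded `J`-sphere at finitely many parameters, or has the same image

C. Wendl, *Holomorphic Curves in Low Dimensions*, LNM 2216 (2018), **Thm. 2.49** (positivity of
intersections, p. 62), first assertion: *two closed connected `J`-holomorphic curves `u, v` in
an almost complex 4-manifold with non-identical images have finitely many intersections*;
D. McDuff, *The local behaviour of holomorphic curves in almost complex 4-manifolds*, JDG 34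
(1991), **Lemma 2.7** (p. 150): at a point which is nonsingular on one curve, an intersection of
two distinct connected `J`-curves is isolated. We prove the first assertion of Thm. 2.49 in the
case consumed by the uniqueness clause of the Hofer–Lizan–Sikorav local foliation statement
`Literature.Geometry.Symplectic.hls_localFoliation_embeddedSphere_trivialNormal`
(`JSphereLocalFoliation.lean`; Wendl Prop. 2.53 with Thm. 2.49): one of the two curves is an
EMBEDDED `JX`-holomorphic two-chart sphere `Σ = range u₀ ∪ {v₀ 0}` (`v₀ z = u₀ z⁻¹`, `u₀`
injective and immersed, `v₀` immersed at `0`, `v₀ 0 ∉ range u₀` — the vocabulary of that file),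
the other an arbitrary smooth `JX`-holomorphic two-chart sphere `(u, v)`.

## What is proved (no definitions, no named facts)

* `twoChart_isolated_or_nested` — McDuff's Lemma 2.7 read against `Σ`: for `γ` smooth,
  `JX`-holomorphic, not locally constant at `z₀`, with `γ z₀ ∈ Σ`, EITHER `γ z ∉ Σ` for all
  `z ≠ z₀` near `z₀`, OR `γ` maps a neighbourhood of `z₀` into `Σ` and `γ(B_ρ(z₀))` contains a
  relative neighbourhood of `γ z₀` in `Σ` for every `ρ > 0`. This is the PROVED named fact
  `jHolomorphic_intersectionDichotomy` (`JHolomorphicIntersectionDichotomy.lean`) applied to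
  `γ(· + z₀)` and the local regular parametrisation of `Σ` at `γ z₀` (a translate of `u₀`, or
  `v₀`), together with the elementary fact that small parameter discs of an injective two-chart
  sphere have relatively open images (`twoChart_cover_fst`, `twoChart_cover_snd`).
* `twoChart_preimage_eq_univ_or_finite` — **`u⁻¹(Σ)` is `ℂ` or finite**, with NO unique
  continuation hypothesis: every point of the closed set `u⁻¹(Σ)` is interior or isolated
  (points where `u` is locally constant are interior), so its interior is closed, hence `∅` or
  `ℂ`; in the first case `u⁻¹(Σ)` is discrete, and bounded by the same alternative for `v` at
  `0`, hence finite.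
* `twoChart_range_union_eq_of_forall_mem` — **a non-constant `J`-sphere inside `Σ` covers `Σ`**,
  assuming the named fact `jHolomorphic_uniqueContinuation_const` (McDuff 1991, Lemma 2.3;
  `JHolomorphicLocalIntersections.lean`) as an explicit hypothesis: then `u`, `v` are nowhere
  locally constant, the nested alternative makes `range u ∪ {v 0}` relatively open in `Σ`, it is
  compact, and `Σ` is connected.
* `twoChart_range_union_eq_or_finite` — the two combined: Wendl Thm. 2.49, first assertion, for
  `(u, v)` non-constant against the embedded `Σ`.

Also recorded: the bridge `AlmostComplexStructure.contMDiffAt_inTangentCoordinates` from the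
bundled `AlmostComplexStructure` (a smooth section of `End(TX)`) to the `inTangentCoordinates`
regularity hypothesis of the local theory, and translation lemmas for `J`-holomorphic maps.
Deliberately NOT here: the counting half of Thm. 2.49 (`[u] · [v] ≥ #` with local indices; tree:
`positivityOfIntersections_leafCoordinate_holds`, `sphere_zeroSetIndex_factorsThroughHomology`)
and non-embedded targets.

## References

* C. Wendl, *Holomorphic Curves in Low Dimensions*, Lecture Notes in Math. 2216, Springer (2018),
  Thm. 2.49, Prop. 2.53. [Wendl2018]
* D. McDuff, *The local behaviour of holomorphic curves in almost complex 4-manifolds*,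
  J. Differential Geom. 34 (1991) 143–164, Lemma 2.7, Lemma 2.3. [McDuff1991LocalBehaviour]
-/

noncomputable section

open scoped Manifold ContDiff Topology
open Set Function Metric Filter Bundle

namespace Literature.Geometry.Symplectic

section Bridge

variable {X : Type} [TopologicalSpace X] [ChartedSpace (EuclideanSpace ℝ (Fin 4)) X]
  [IsManifold (𝓡 4) ∞ X]

/-- **A smooth almost complex structure is smooth in tangent coordinates**: the coordinate
expression `inTangentCoordinates … (fun x ↦ J x) x₀` of the section `J` of `End(TX)` is `C^∞`
at `x₀` (the second component of `contMDiffAt_hom_bundle`). This is the regularity hypothesis of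
the local intersection theory of `JHolomorphicLocalIntersections.lean`. [folklore] -/
theorem AlmostComplexStructure.contMDiffAt_inTangentCoordinates
    (J : AlmostComplexStructure (𝓡 4) ∞ X) (x₀ : X) :
    ContMDiffAt (𝓡 4) 𝓘(ℝ, EuclideanSpace ℝ (Fin 4) →L[ℝ] EuclideanSpace ℝ (Fin 4)) ∞
      (inTangentCoordinates (𝓡 4) (𝓡 4) (id : X → X) id
        (fun x => (J x : TangentSpace (𝓡 4) x →L[ℝ] TangentSpace (𝓡 4) x)) x₀) x₀ :=
  ((contMDiffAt_hom_bundle (IB := 𝓡 4) (n := ∞) (F₁ := EuclideanSpace ℝ (Fin 4))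
    (F₂ := EuclideanSpace ℝ (Fin 4)) (E₁ := (TangentSpace (𝓡 4) : X → Type _))
    (E₂ := (TangentSpace (𝓡 4) : X → Type _))
    (fun y : X ↦ TotalSpace.mk' (EuclideanSpace ℝ (Fin 4) →L[ℝ] EuclideanSpace ℝ (Fin 4)) y
      (J y : TangentSpace (𝓡 4) y →L[ℝ] TangentSpace (𝓡 4) y)) (x₀ := x₀)).1 (J.contMDiff' x₀)).2

end Bridge

/-! ### Two-chart spheres: elementary covering lemmas -/

section TwoChart

variable {X : Type*}

/-- The image `range u ∪ {v 0}` of a two-chart sphere (`v z = u z⁻¹` for `z ≠ 0`) is the union of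
the images of the two closed unit discs. [folklore] -/
theorem twoChart_range_union_eq (u v : ℂ → X) (huv : ∀ z : ℂ, z ≠ 0 → v z = u z⁻¹) :
    range u ∪ {v 0} = u '' closedBall 0 1 ∪ v '' closedBall 0 1 := by
  ext p
  constructor
  · rintro (⟨z, rfl⟩ | rfl)
    · by_cases hz : ‖z‖ ≤ 1
      · exact Or.inl ⟨z, by simpa using hz, rfl⟩
      · have hz0 : z ≠ 0 := by
          rintro rfl
          simp at hz
        refine Or.inr ⟨z⁻¹, ?_, ?_⟩
        · rw [mem_closedBall, dist_zero_right, norm_inv]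
          exact inv_le_one_of_one_le₀ (le_of_lt (not_le.1 hz))
        · rw [huv _ (inv_ne_zero hz0), inv_inv]
    · exact Or.inr ⟨0, by simp, rfl⟩
  · rintro (⟨z, -, rfl⟩ | ⟨w, -, rfl⟩)
    · exact Or.inl ⟨z, rfl⟩
    · by_cases hw : w = 0
      · subst hw
        exact Or.inr rfl
      · exact Or.inl ⟨w⁻¹, (huv w hw).symm⟩

/-- The second chart of a two-chart sphere takes values in `range u ∪ {v 0}`. [folklore] -/
theorem twoChart_range_snd_subset {u v : ℂ → X} (huv : ∀ z : ℂ, z ≠ 0 → v z = u z⁻¹) :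
    range v ⊆ range u ∪ {v 0} := by
  rintro _ ⟨w, rfl⟩
  by_cases hw : w = 0
  · subst hw
    exact Or.inr rfl
  · exact Or.inl ⟨w⁻¹, (huv w hw).symm⟩

/-- The translate `z ↦ u (z + z₀)` maps the disc `ball 0 ρ` into the image of `ball z₀ ρ`.
[folklore] -/
theorem image_comp_add_right_ball_subset (u : ℂ → X) (z₀ : ℂ) (ρ : ℝ) :
    (u ∘ fun z : ℂ => z + z₀) '' ball 0 ρ ⊆ u '' ball z₀ ρ := by
  rintro _ ⟨s, hs, rfl⟩
  refine ⟨s + z₀, ?_, rfl⟩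
  simpa [mem_ball, dist_eq_norm] using hs

/-- The image of `ball z₀ ρ` is contained in the image of `ball 0 ρ` under the translate.
[folklore] -/
theorem image_ball_subset_image_comp_add_right (u : ℂ → X) (z₀ : ℂ) (ρ : ℝ) :
    u '' ball z₀ ρ ⊆ (u ∘ fun z : ℂ => z + z₀) '' ball 0 ρ := by
  rintro _ ⟨z, hz, rfl⟩
  refine ⟨z - z₀, ?_, by simp⟩
  simpa [mem_ball, dist_eq_norm] using hz

variable [TopologicalSpace X]

/-- The image of a two-chart sphere with continuous charts is compact. [folklore] -/
theorem isCompact_twoChart_range_union {u v : ℂ → X} (hu : Continuous u) (hv : Continuous v)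
    (huv : ∀ z : ℂ, z ≠ 0 → v z = u z⁻¹) : IsCompact (range u ∪ {v 0}) := by
  rw [twoChart_range_union_eq u v huv]
  exact ((isCompact_closedBall 0 1).image hu).union ((isCompact_closedBall 0 1).image hv)

/-- The image of a two-chart sphere with continuous charts is preconnected. [folklore] -/
theorem isPreconnected_twoChart_range_union {u v : ℂ → X} (hu : Continuous u)
    (hv : Continuous v) (huv : ∀ z : ℂ, z ≠ 0 → v z = u z⁻¹) :
    IsPreconnected (range u ∪ {v 0}) := by
  rw [twoChart_range_union_eq u v huv]
  refine IsPreconnected.union (u 1) ⟨1, by simp, rfl⟩ ⟨1, by simp, ?_⟩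
    ((convex_closedBall (0 : ℂ) 1).isPreconnected.image u hu.continuousOn)
    ((convex_closedBall (0 : ℂ) 1).isPreconnected.image v hv.continuousOn)
  rw [huv 1 one_ne_zero, inv_one]

/-- In a two-chart sphere, if `u` takes all its values in a closed set then so does `v`
(`v 0` is a limit of values `u z⁻¹`). [folklore] -/
theorem twoChart_snd_mem_of_fst_mem {u v : ℂ → X} (hv : Continuous v)
    (huv : ∀ z : ℂ, z ≠ 0 → v z = u z⁻¹) {S : Set X} (hS : IsClosed S) (h : ∀ z, u z ∈ S)
    (w : ℂ) : v w ∈ S := by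
  by_cases hw : w = 0
  · subst hw
    have hmem : ∀ᶠ z in 𝓝[≠] (0 : ℂ), v z ∈ S := by
      refine eventually_nhdsWithin_of_forall fun z hz => ?_
      rw [huv z hz]
      exact h _
    exact hS.mem_of_tendsto ((hv.tendsto 0).mono_left nhdsWithin_le_nhds) hmem
  · rw [huv w hw]
    exact h _

/-- If the first chart map of a two-chart sphere is constant then so is the second, with the
same value. [folklore] -/
theorem twoChart_snd_eq_of_fst_eq [T1Space X] {u v : ℂ → X} (hv : Continuous v)
    (huv : ∀ z : ℂ, z ≠ 0 → v z = u z⁻¹) {p : X} (h : ∀ z, u z = p) (w : ℂ) : v w = p := by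
  have := twoChart_snd_mem_of_fst_mem hv huv (isClosed_singleton (x := p)) (fun z => (h z : _)) w
  simpa using this

variable [T2Space X]

/-- **Small discs of the first chart are relatively open in `Σ`.** For an injective two-chart
sphere `(u₀, v₀)` with `v₀ 0 ∉ range u₀`, the complement of `u₀(B_ρ(ζ₀))` in
`Σ = range u₀ ∪ {v₀ 0}` is contained in a closed set missing `u₀ ζ₀`. [folklore] -/
theorem twoChart_cover_fst {u₀ v₀ : ℂ → X} (hu₀ : Continuous u₀) (hv₀ : Continuous v₀)
    (huv₀ : ∀ z : ℂ, z ≠ 0 → v₀ z = u₀ z⁻¹) (hinj : Injective u₀) (hnot : v₀ 0 ∉ range u₀)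
    (ζ₀ : ℂ) {ρ : ℝ} (hρ : 0 < ρ) :
    ∃ C : Set X, IsClosed C ∧ u₀ ζ₀ ∉ C ∧ range u₀ ∪ {v₀ 0} ⊆ u₀ '' ball ζ₀ ρ ∪ C := by
  set R : ℝ := ‖ζ₀‖ + ρ + 1 with hR
  have hRpos : 0 < R := by positivity
  refine ⟨u₀ '' (closedBall 0 R \ ball ζ₀ ρ) ∪ v₀ '' closedBall 0 R⁻¹, ?_, ?_, ?_⟩
  · exact ((((isCompact_closedBall 0 R).diff isOpen_ball).image hu₀).union
      ((isCompact_closedBall 0 R⁻¹).image hv₀)).isClosed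
  · rintro (⟨z, ⟨-, hzb⟩, hz⟩ | ⟨w, hw, hwz⟩)
    · exact hzb (by rw [hinj hz]; exact mem_ball_self hρ)
    · by_cases hw0 : w = 0
      · subst hw0
        exact hnot ⟨ζ₀, hwz.symm⟩
      · rw [huv₀ w hw0] at hwz
        have hwζ : w⁻¹ = ζ₀ := hinj hwz
        rw [mem_closedBall, dist_zero_right] at hw
        have hwpos : 0 < ‖w‖ := norm_pos_iff.2 hw0
        have h1 : R ≤ ‖ζ₀‖ := by
          rw [← hwζ, norm_inv, le_inv_comm₀ hRpos hwpos]
          exact hw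
        have h2 : ‖ζ₀‖ < R := by rw [hR]; linarith
        exact absurd h1 (not_le.2 h2)
  · rintro p (⟨z, rfl⟩ | rfl)
    · by_cases hzb : z ∈ ball ζ₀ ρ
      · exact Or.inl ⟨z, hzb, rfl⟩
      · by_cases hzR : ‖z‖ ≤ R
        · exact Or.inr (Or.inl ⟨z, ⟨by simpa using hzR, hzb⟩, rfl⟩)
        · have hRz : R < ‖z‖ := not_le.1 hzR
          have hz0 : z ≠ 0 := by
            rintro rfl
            exact hzR (by simpa using hRpos.le)
          refine Or.inr (Or.inr ⟨z⁻¹, ?_, ?_⟩)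
          · rw [mem_closedBall, dist_zero_right, norm_inv]
            exact ((inv_lt_inv₀ (lt_trans hRpos hRz) hRpos).2 hRz).le
          · rw [huv₀ _ (inv_ne_zero hz0), inv_inv]
    · exact Or.inr (Or.inr ⟨0, by simpa using hRpos.le, rfl⟩)

/-- **Small discs of the second chart about `0` are relatively open in `Σ`.** [folklore] -/
theorem twoChart_cover_snd {u₀ v₀ : ℂ → X} (hu₀ : Continuous u₀)
    (huv₀ : ∀ z : ℂ, z ≠ 0 → v₀ z = u₀ z⁻¹) (hnot : v₀ 0 ∉ range u₀) {ρ : ℝ} (hρ : 0 < ρ) :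
    ∃ C : Set X, IsClosed C ∧ v₀ 0 ∉ C ∧ range u₀ ∪ {v₀ 0} ⊆ v₀ '' ball 0 ρ ∪ C := by
  refine ⟨u₀ '' closedBall 0 ρ⁻¹, ((isCompact_closedBall 0 ρ⁻¹).image hu₀).isClosed,
    fun ⟨z, _, hz⟩ => hnot ⟨z, hz⟩, ?_⟩
  rintro p (⟨z, rfl⟩ | rfl)
  · by_cases hz : ‖z‖ ≤ ρ⁻¹
    · exact Or.inr ⟨z, by simpa using hz, rfl⟩
    · have hzpos : ρ⁻¹ < ‖z‖ := not_le.1 hz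
      have hz0 : z ≠ 0 := by
        rintro rfl
        exact hz (by simpa using hρ.le)
      refine Or.inl ⟨z⁻¹, ?_, ?_⟩
      · rw [mem_ball, dist_zero_right, norm_inv]
        exact inv_lt_of_inv_lt₀ hρ hzpos
      · rw [huv₀ _ (inv_ne_zero hz0), inv_inv]
  · exact Or.inl ⟨0, mem_ball_self hρ, rfl⟩

end TwoChart

/-! ### Translating the source -/

section TranslateC

/-- Transfer of `∀ᶠ` along the translation `s ↦ s + z₀` of `ℂ`. [folklore] -/
theorem eventually_nhds_add_right_iff {p : ℂ → Prop} {z₀ : ℂ} :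
    (∀ᶠ s in 𝓝 (0 : ℂ), p (s + z₀)) ↔ ∀ᶠ z in 𝓝 z₀, p z := by
  have h := (Homeomorph.addRight z₀).map_nhds_eq (0 : ℂ)
  simp only [Homeomorph.coe_addRight, zero_add] at h
  rw [← h, Filter.eventually_map]

/-- Transfer of `∃ᶠ` along the translation `s ↦ s + z₀` of `ℂ`. [folklore] -/
theorem frequently_nhds_add_right_iff {p : ℂ → Prop} {z₀ : ℂ} :
    (∃ᶠ s in 𝓝 (0 : ℂ), p (s + z₀)) ↔ ∃ᶠ z in 𝓝 z₀, p z := by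
  have h := (Homeomorph.addRight z₀).map_nhds_eq (0 : ℂ)
  simp only [Homeomorph.coe_addRight, zero_add] at h
  rw [← h, Filter.frequently_map]

/-- Transfer of `∀ᶠ` on punctured neighbourhoods along `s ↦ s + z₀`. [folklore] -/
theorem eventually_nhdsNE_add_right_iff {p : ℂ → Prop} {z₀ : ℂ} :
    (∀ᶠ s in 𝓝[≠] (0 : ℂ), p (s + z₀)) ↔ ∀ᶠ z in 𝓝[≠] z₀, p z := by
  rw [eventually_nhdsWithin_iff, eventually_nhdsWithin_iff,
    ← eventually_nhds_add_right_iff (z₀ := z₀)]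
  refine Filter.eventually_congr (Filter.Eventually.of_forall fun s => ?_)
  simp only [mem_compl_iff, mem_singleton_iff, add_eq_right]

end TranslateC

section Translate

variable {X : Type} [TopologicalSpace X] [ChartedSpace (EuclideanSpace ℝ (Fin 4)) X]
  {J : ∀ x : X, TangentSpace (𝓡 4) x →L[ℝ] TangentSpace (𝓡 4) x} {u : ℂ → X}

/-- A translate `z ↦ u (z + z₀)` of a smooth map is smooth. [folklore] -/
theorem contMDiff_comp_add_right (hu : ContMDiff 𝓘(ℝ, ℂ) (𝓡 4) ∞ u) (z₀ : ℂ) :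
    ContMDiff 𝓘(ℝ, ℂ) (𝓡 4) ∞ (u ∘ fun z : ℂ => z + z₀) :=
  hu.comp (contMDiff_iff_contDiff.2 (contDiff_id.add contDiff_const))

/-- A translate of a smooth `J`-holomorphic map is `J`-holomorphic (Hummel 1997, Ch. I §3:
holomorphic reparametrisations of the source). [folklore] -/
theorem IsJHolomorphic.comp_add_right (hJ : IsJHolomorphic (𝓡 4) J u)
    (hu : ContMDiff 𝓘(ℝ, ℂ) (𝓡 4) ∞ u) (z₀ : ℂ) :
    IsJHolomorphic (𝓡 4) J (u ∘ fun z : ℂ => z + z₀) :=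
  hJ.comp_of_differentiable (differentiable_id.add_const z₀)
    fun _ => (hu _).mdifferentiableAt (by simp)

/-- The differential of the translate `z ↦ u (z + z₀)` at `0` is injective when `du(z₀)` is.
[folklore] -/
theorem injective_mfderiv_comp_add_right (hu : ContMDiff 𝓘(ℝ, ℂ) (𝓡 4) ∞ u) {z₀ : ℂ}
    (h : Injective (mfderiv 𝓘(ℝ, ℂ) (𝓡 4) u z₀)) :
    Injective (mfderiv 𝓘(ℝ, ℂ) (𝓡 4) (u ∘ fun z : ℂ => z + z₀) 0) := by
  have h1 : HasMFDerivAt 𝓘(ℝ, ℂ) 𝓘(ℝ, ℂ) (fun z : ℂ => z + z₀) 0 (ContinuousLinearMap.id ℝ ℂ) :=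
    ((hasFDerivAt_id (𝕜 := ℝ) (0 : ℂ)).add_const z₀).hasMFDerivAt
  have h2 : HasMFDerivAt 𝓘(ℝ, ℂ) (𝓡 4) u ((fun z : ℂ => z + z₀) 0)
      (mfderiv 𝓘(ℝ, ℂ) (𝓡 4) u z₀) := by
    have h0 : (fun z : ℂ => z + z₀) 0 = z₀ := zero_add z₀
    rw [h0]
    exact ((hu z₀).mdifferentiableAt (by simp)).hasMFDerivAt
  rw [(h2.comp 0 h1).mfderiv]
  intro a b hab
  exact h hab

end Translate

/-! ### The embedded sphere `Σ = range u₀ ∪ {v₀ 0}`: local regular parametrisations -/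

section Embedded

variable {X : Type} [TopologicalSpace X] [T2Space X]
  [ChartedSpace (EuclideanSpace ℝ (Fin 4)) X] [IsManifold (𝓡 4) ∞ X]
  {JX : AlmostComplexStructure (𝓡 4) ∞ X} {u₀ v₀ : ℂ → X}

/-- **Local regular `JX`-holomorphic parametrisations of an embedded two-chart sphere.** Every
point `p` of `Σ = range u₀ ∪ {v₀ 0}` is `G 0` for a smooth `JX`-holomorphic `G : ℂ → X` with
`dG(0)` injective, `range G ⊆ Σ`, and `G(B_ρ(0))` relatively open in `Σ` about `p` for every
`ρ > 0` (a translate of `u₀`, or `v₀` itself). [folklore] -/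
theorem exists_localParam_of_mem_twoChart (hu₀ : ContMDiff 𝓘(ℝ, ℂ) (𝓡 4) ∞ u₀)
    (hv₀ : ContMDiff 𝓘(ℝ, ℂ) (𝓡 4) ∞ v₀) (huv₀ : ∀ z : ℂ, z ≠ 0 → v₀ z = u₀ z⁻¹)
    (hJu₀ : IsJHolomorphic (𝓡 4) (fun y => JX y) u₀)
    (hJv₀ : IsJHolomorphic (𝓡 4) (fun y => JX y) v₀) (hinj : Injective u₀)
    (himm : ∀ z, Injective (mfderiv 𝓘(ℝ, ℂ) (𝓡 4) u₀ z))
    (himm₀ : Injective (mfderiv 𝓘(ℝ, ℂ) (𝓡 4) v₀ 0)) (hnot : v₀ 0 ∉ range u₀)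
    {p : X} (hp : p ∈ range u₀ ∪ {v₀ 0}) :
    ∃ G : ℂ → X, ContMDiff 𝓘(ℝ, ℂ) (𝓡 4) ∞ G ∧ IsJHolomorphic (𝓡 4) (fun y => JX y) G ∧
      G 0 = p ∧ Injective (mfderiv 𝓘(ℝ, ℂ) (𝓡 4) G 0) ∧ range G ⊆ range u₀ ∪ {v₀ 0} ∧
      ∀ ρ : ℝ, 0 < ρ → ∃ C : Set X, IsClosed C ∧ p ∉ C ∧
        range u₀ ∪ {v₀ 0} ⊆ G '' ball 0 ρ ∪ C := by
  rcases hp with ⟨ζ₀, rfl⟩ | rfl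
  · refine ⟨u₀ ∘ fun z => z + ζ₀, contMDiff_comp_add_right hu₀ ζ₀, hJu₀.comp_add_right hu₀ ζ₀,
      by simp, injective_mfderiv_comp_add_right hu₀ (himm ζ₀), ?_, fun ρ hρ => ?_⟩
    · rintro _ ⟨s, rfl⟩
      exact Or.inl ⟨s + ζ₀, rfl⟩
    · obtain ⟨C, hC, hpC, hcov⟩ :=
        twoChart_cover_fst hu₀.continuous hv₀.continuous huv₀ hinj hnot ζ₀ hρ
      exact ⟨C, hC, hpC, hcov.trans (union_subset_union_left _
        (image_ball_subset_image_comp_add_right u₀ ζ₀ ρ))⟩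
  · exact ⟨v₀, hv₀, hJv₀, rfl, himm₀, twoChart_range_snd_subset huv₀, fun ρ hρ =>
      twoChart_cover_snd hu₀.continuous huv₀ hnot hρ⟩

end Embedded

/-! ### The dichotomy at one parameter value -/

section Local

variable {X : Type} [TopologicalSpace X] [T2Space X] [SecondCountableTopology X]
  [ChartedSpace (EuclideanSpace ℝ (Fin 4)) X] [IsManifold (𝓡 4) ∞ X]
  {JX : AlmostComplexStructure (𝓡 4) ∞ X} {u₀ v₀ : ℂ → X}

/-- **McDuff's dichotomy read against an embedded sphere** (McDuff 1991, Lemma 2.7; Wendl 2018,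
Thm. 2.49). Let `Σ = range u₀ ∪ {v₀ 0}` be an embedded `JX`-holomorphic two-chart sphere and
`γ : ℂ → X` smooth, `JX`-holomorphic, not locally constant at `z₀`, with `γ z₀ ∈ Σ`. Then EITHER
`γ z ∉ Σ` for all `z ≠ z₀` near `z₀` (isolated intersection), OR `γ` maps a neighbourhood of `z₀`
into `Σ` and, for every `ρ > 0`, `γ(B_ρ(z₀))` contains a relative neighbourhood of `γ z₀` in `Σ`
(same image germ). [cite: McDuff1991LocalBehaviour, Lemma 2.7] -/
theorem twoChart_isolated_or_nested (hu₀ : ContMDiff 𝓘(ℝ, ℂ) (𝓡 4) ∞ u₀)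
    (hv₀ : ContMDiff 𝓘(ℝ, ℂ) (𝓡 4) ∞ v₀) (huv₀ : ∀ z : ℂ, z ≠ 0 → v₀ z = u₀ z⁻¹)
    (hJu₀ : IsJHolomorphic (𝓡 4) (fun y => JX y) u₀)
    (hJv₀ : IsJHolomorphic (𝓡 4) (fun y => JX y) v₀) (hinj : Injective u₀)
    (himm : ∀ z, Injective (mfderiv 𝓘(ℝ, ℂ) (𝓡 4) u₀ z))
    (himm₀ : Injective (mfderiv 𝓘(ℝ, ℂ) (𝓡 4) v₀ 0)) (hnot : v₀ 0 ∉ range u₀)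
    {γ : ℂ → X} (hγ : ContMDiff 𝓘(ℝ, ℂ) (𝓡 4) ∞ γ) (hJγ : IsJHolomorphic (𝓡 4) (fun y => JX y) γ)
    {z₀ : ℂ} (hz₀ : γ z₀ ∈ range u₀ ∪ {v₀ 0}) (hnc : ∃ᶠ z in 𝓝 z₀, γ z ≠ γ z₀) :
    (∀ᶠ z in 𝓝[≠] z₀, γ z ∉ range u₀ ∪ {v₀ 0}) ∨
    ((∀ᶠ z in 𝓝 z₀, γ z ∈ range u₀ ∪ {v₀ 0}) ∧
      ∀ ρ : ℝ, 0 < ρ → ∃ O ∈ 𝓝 (γ z₀), O ∩ (range u₀ ∪ {v₀ 0}) ⊆ γ '' ball z₀ ρ) := by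
  obtain ⟨G, hG, hGJ, hG0, hGinj, hGr, hGcov⟩ :=
    exists_localParam_of_mem_twoChart hu₀ hv₀ huv₀ hJu₀ hJv₀ hinj himm himm₀ hnot hz₀
  set G₁ : ℂ → X := γ ∘ fun z : ℂ => z + z₀ with hG₁
  have hG₁s : ContMDiff 𝓘(ℝ, ℂ) (𝓡 4) ∞ G₁ := contMDiff_comp_add_right hγ z₀
  have hG₁J : IsJHolomorphic (𝓡 4) (fun y => JX y) G₁ := hJγ.comp_add_right hγ z₀
  have hG₁0 : G₁ 0 = γ z₀ := by simp [hG₁]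
  have h00 : G₁ 0 = G 0 := by rw [hG₁0, hG0]
  have hfreq : ∃ᶠ z in 𝓝 (0 : ℂ), G₁ z ≠ G₁ 0 := by
    rw [hG₁0]
    exact (frequently_nhds_add_right_iff (p := fun z => γ z ≠ γ z₀)).2 hnc
  rcases jHolomorphic_intersectionDichotomy_holds X (fun x => JX x) (fun x v => JX.map_map x v)
      (fun x₀ => JX.contMDiffAt_inTangentCoordinates x₀) G₁ G hG₁s hG₁J hG hGJ h00 hGinj hfreq
    with ⟨ρ, hρ, hiso⟩ | hnest
  · -- isolated pair of parameters ⇒ isolated intersection with `Σ`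
    left
    obtain ⟨C, hC, hpC, hcov⟩ := hGcov ρ hρ
    have h1 : ∀ᶠ s in 𝓝 (0 : ℂ), s ∈ ball (0 : ℂ) ρ := ball_mem_nhds 0 hρ
    have h2 : ∀ᶠ s in 𝓝 (0 : ℂ), G₁ s ∈ Cᶜ := by
      refine (hG₁s.continuous.tendsto 0).eventually (hC.isOpen_compl.mem_nhds ?_)
      rwa [hG₁0]
    rw [← eventually_nhdsNE_add_right_iff (z₀ := z₀), eventually_nhdsWithin_iff]
    filter_upwards [h1, h2] with s hs hsC hs0 hsT
    rcases hcov hsT with ⟨t, ht, hts⟩ | hsC'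
    · exact hs0 (hiso s hs t ht hts.symm).1
    · exact hsC hsC'
  · right
    constructor
    · obtain ⟨ρ', hρ', hsub, -⟩ := hnest 1 one_pos
      rw [← eventually_nhds_add_right_iff (z₀ := z₀)]
      filter_upwards [ball_mem_nhds (0 : ℂ) hρ'] with s hs
      rcases hsub ⟨s, hs, rfl⟩ with ⟨t, -, hts⟩
      have hmem : G t ∈ range u₀ ∪ {v₀ 0} := hGr ⟨t, rfl⟩
      have hGs : G₁ s = γ (s + z₀) := rfl
      rw [hts, hGs] at hmem
      exact hmem
    · intro ρ hρ
      obtain ⟨ρ', hρ', -, hsub⟩ := hnest ρ hρ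
      obtain ⟨C, hC, hpC, hcov⟩ := hGcov ρ' hρ'
      refine ⟨Cᶜ, hC.isOpen_compl.mem_nhds hpC, fun x ⟨hxC, hxT2⟩ => ?_⟩
      rcases hcov hxT2 with hxG | hxC'
      · exact image_comp_add_right_ball_subset γ z₀ ρ (hsub hxG)
      · exact absurd hxC' hxC

/-- **Interior-or-isolated.** With `Σ` as above and `γ` smooth `JX`-holomorphic with `γ z₀ ∈ Σ`
(possibly locally constant at `z₀`): either `γ` maps a neighbourhood of `z₀` into `Σ`, or
`γ z ∉ Σ` for all `z ≠ z₀` near `z₀`. [cite: McDuff1991LocalBehaviour, Lemma 2.7] -/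
theorem twoChart_eventually_mem_or_eventually_not_mem (hu₀ : ContMDiff 𝓘(ℝ, ℂ) (𝓡 4) ∞ u₀)
    (hv₀ : ContMDiff 𝓘(ℝ, ℂ) (𝓡 4) ∞ v₀) (huv₀ : ∀ z : ℂ, z ≠ 0 → v₀ z = u₀ z⁻¹)
    (hJu₀ : IsJHolomorphic (𝓡 4) (fun y => JX y) u₀)
    (hJv₀ : IsJHolomorphic (𝓡 4) (fun y => JX y) v₀) (hinj : Injective u₀)
    (himm : ∀ z, Injective (mfderiv 𝓘(ℝ, ℂ) (𝓡 4) u₀ z))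
    (himm₀ : Injective (mfderiv 𝓘(ℝ, ℂ) (𝓡 4) v₀ 0)) (hnot : v₀ 0 ∉ range u₀)
    {γ : ℂ → X} (hγ : ContMDiff 𝓘(ℝ, ℂ) (𝓡 4) ∞ γ) (hJγ : IsJHolomorphic (𝓡 4) (fun y => JX y) γ)
    {z₀ : ℂ} (hz₀ : γ z₀ ∈ range u₀ ∪ {v₀ 0}) :
    (∀ᶠ z in 𝓝 z₀, γ z ∈ range u₀ ∪ {v₀ 0}) ∨ (∀ᶠ z in 𝓝[≠] z₀, γ z ∉ range u₀ ∪ {v₀ 0}) := by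
  by_cases hlc : ∀ᶠ z in 𝓝 z₀, γ z = γ z₀
  · exact Or.inl (hlc.mono fun z hz => hz ▸ hz₀)
  · have hnc : ∃ᶠ z in 𝓝 z₀, γ z ≠ γ z₀ := Filter.not_eventually.1 hlc
    rcases twoChart_isolated_or_nested hu₀ hv₀ huv₀ hJu₀ hJv₀ hinj himm himm₀ hnot hγ hJγ hz₀ hnc
      with h | ⟨h, -⟩
    · exact Or.inr h
    · exact Or.inl h

end Local

/-! ### The global statements -/

section Global

variable {X : Type} [TopologicalSpace X] [T2Space X] [SecondCountableTopology X]
  [ChartedSpace (EuclideanSpace ℝ (Fin 4)) X] [IsManifold (𝓡 4) ∞ X]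

/-- **A `J`-sphere meets an embedded `J`-sphere at finitely many parameters, or lies in it**
(Wendl 2018, Thm. 2.49, first assertion, in the embedded case; McDuff 1991, Lemma 2.7). In an
almost complex 4-manifold `(X, JX)` let `Σ = range u₀ ∪ {v₀ 0}` be an embedded `JX`-holomorphic
two-chart sphere and `(u, v)` (`v z = u z⁻¹`) a smooth `JX`-holomorphic two-chart sphere. Then
either `u` takes ALL its values in `Σ`, or only FINITELY many `z` have `u z ∈ Σ`. (No unique
continuation is needed: the interior of the closed set `u⁻¹(Σ)` is closed because every point of
`u⁻¹(Σ)` is interior or isolated, hence it is `∅` or `ℂ`; in the first case `u⁻¹(Σ)` is discrete,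
and it is bounded by the same alternative for `v` at `0`.)
[cite: Wendl2018, Thm. 2.49] [cite: McDuff1991LocalBehaviour, Lemma 2.7] -/
theorem twoChart_preimage_eq_univ_or_finite (JX : AlmostComplexStructure (𝓡 4) ∞ X)
    {u₀ v₀ : ℂ → X} (hu₀ : ContMDiff 𝓘(ℝ, ℂ) (𝓡 4) ∞ u₀)
    (hv₀ : ContMDiff 𝓘(ℝ, ℂ) (𝓡 4) ∞ v₀) (huv₀ : ∀ z : ℂ, z ≠ 0 → v₀ z = u₀ z⁻¹)
    (hJu₀ : IsJHolomorphic (𝓡 4) (fun y => JX y) u₀)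
    (hJv₀ : IsJHolomorphic (𝓡 4) (fun y => JX y) v₀) (hinj : Injective u₀)
    (himm : ∀ z, Injective (mfderiv 𝓘(ℝ, ℂ) (𝓡 4) u₀ z))
    (himm₀ : Injective (mfderiv 𝓘(ℝ, ℂ) (𝓡 4) v₀ 0)) (hnot : v₀ 0 ∉ range u₀)
    {u v : ℂ → X} (hu : ContMDiff 𝓘(ℝ, ℂ) (𝓡 4) ∞ u) (hv : ContMDiff 𝓘(ℝ, ℂ) (𝓡 4) ∞ v)
    (huv : ∀ z : ℂ, z ≠ 0 → v z = u z⁻¹) (hJu : IsJHolomorphic (𝓡 4) (fun y => JX y) u)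
    (hJv : IsJHolomorphic (𝓡 4) (fun y => JX y) v) :
    {z : ℂ | u z ∈ range u₀ ∪ {v₀ 0}} = univ ∨ {z : ℂ | u z ∈ range u₀ ∪ {v₀ 0}}.Finite := by
  set T : Set X := range u₀ ∪ {v₀ 0} with hT
  have hTc : IsClosed T := (isCompact_twoChart_range_union hu₀.continuous hv₀.continuous huv₀).isClosed
  set S : Set ℂ := {z : ℂ | u z ∈ T} with hS
  have hSc : IsClosed S := hTc.preimage hu.continuous
  have key : ∀ z₀ ∈ S, (∀ᶠ z in 𝓝 z₀, z ∈ S) ∨ (∀ᶠ z in 𝓝[≠] z₀, z ∉ S) := fun z₀ hz₀ =>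
    twoChart_eventually_mem_or_eventually_not_mem hu₀ hv₀ huv₀ hJu₀ hJv₀ hinj himm himm₀ hnot
      hu hJu hz₀
  -- the interior of `S` is closed
  have hclosed : IsClosed (interior S) := by
    refine isClosed_of_closure_subset fun z₁ hz₁ => ?_
    have hz₁S : z₁ ∈ S := closure_minimal interior_subset hSc hz₁
    rcases key z₁ hz₁S with h | h
    · exact mem_interior_iff_mem_nhds.2 h
    · rw [eventually_nhdsWithin_iff] at h
      obtain ⟨z₂, hz₂, hz₂'⟩ := mem_closure_iff_nhds.1 hz₁ _ h
      by_cases hne : z₂ = z₁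
      · exact hne ▸ hz₂'
      · exact absurd (interior_subset hz₂') (hz₂ hne)
  rcases isClopen_iff.1 ⟨hclosed, isOpen_interior⟩ with h0 | h1
  · -- `interior S = ∅`: every point of `S` is isolated; bounded via `v` at `0`; hence finite
    right
    have hiso : ∀ z₀ ∈ S, ∀ᶠ z in 𝓝[≠] z₀, z ∉ S := fun z₀ hz₀ =>
      (key z₀ hz₀).resolve_left fun h => by
        have hmem : z₀ ∈ interior S := mem_interior_iff_mem_nhds.2 h
        rw [h0] at hmem
        exact hmem
    have hbd : ∀ᶠ w in 𝓝[≠] (0 : ℂ), v w ∉ T := by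
      by_cases h0T : v 0 ∈ T
      · rcases twoChart_eventually_mem_or_eventually_not_mem hu₀ hv₀ huv₀ hJu₀ hJv₀ hinj himm
            himm₀ hnot hv hJv (z₀ := 0) h0T with h | h
        · exfalso
          obtain ⟨δ, hδ, hball⟩ := Metric.eventually_nhds_iff_ball.1 h
          have hsub : {z : ℂ | δ⁻¹ < ‖z‖} ⊆ S := fun z hz => by
            have hzpos : 0 < ‖z‖ := lt_trans (inv_pos.2 hδ) hz
            have hz0 : z ≠ 0 := norm_pos_iff.1 hzpos
            have hmem : v z⁻¹ ∈ T := hball _ (by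
              rw [mem_ball, dist_zero_right, norm_inv]
              exact inv_lt_of_inv_lt₀ hδ hz)
            show u z ∈ T
            rwa [huv _ (inv_ne_zero hz0), inv_inv] at hmem
          have hopen : IsOpen {z : ℂ | δ⁻¹ < ‖z‖} := isOpen_lt continuous_const continuous_norm
          have hpt : ((2 * δ⁻¹ : ℝ) : ℂ) ∈ interior S := by
            refine interior_maximal hsub hopen ?_
            show δ⁻¹ < ‖((2 * δ⁻¹ : ℝ) : ℂ)‖
            rw [Complex.norm_real, Real.norm_eq_abs, abs_of_pos (by positivity)]
            linarith [inv_pos.2 hδ]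
          rw [h0] at hpt
          exact hpt
        · exact h
      · exact eventually_nhdsWithin_of_eventually_nhds
          ((hv.continuous.tendsto 0).eventually (hTc.isOpen_compl.mem_nhds h0T))
    rw [eventually_nhdsWithin_iff, Metric.eventually_nhds_iff_ball] at hbd
    obtain ⟨δ, hδ, hδball⟩ := hbd
    have hSbdd : S ⊆ closedBall 0 δ⁻¹ := fun z hz => by
      by_contra hfar
      rw [mem_closedBall, dist_zero_right, not_le] at hfar
      have hzpos : 0 < ‖z‖ := lt_trans (inv_pos.2 hδ) hfar
      have hz0 : z ≠ 0 := norm_pos_iff.1 hzpos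
      have h1 : z⁻¹ ∈ ball (0 : ℂ) δ := by
        rw [mem_ball, dist_zero_right, norm_inv]
        exact inv_lt_of_inv_lt₀ hδ hfar
      have h2 := hδball _ h1 (by simpa using hz0)
      rw [huv _ (inv_ne_zero hz0), inv_inv] at h2
      exact h2 hz
    have hScpt : IsCompact S := (isCompact_closedBall 0 δ⁻¹).of_isClosed_subset hSc hSbdd
    set U : ℂ → Set ℂ := fun z => {y : ℂ | y ∈ ({z}ᶜ : Set ℂ) → y ∉ S} with hU
    have hUn : ∀ z ∈ S, U z ∈ 𝓝 z := fun z hz => by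
      have h := hiso z hz
      rw [eventually_nhdsWithin_iff] at h
      exact h
    obtain ⟨t, -, hcover⟩ := hScpt.elim_nhds_subcover U hUn
    refine t.finite_toSet.subset fun z hz => ?_
    obtain ⟨x, hxt, hzU⟩ := mem_iUnion₂.1 (hcover hz)
    by_cases hzx : z = x
    · rw [hzx]
      exact hxt
    · exact absurd hz (hzU hzx)
  · left
    exact eq_univ_of_univ_subset (h1 ▸ interior_subset)

/-- **A non-constant `J`-sphere lying in an embedded `J`-sphere covers it** (Wendl 2018,
Thm. 2.49, "non-identical images"; McDuff 1991, Lemma 2.7), assuming unique continuation for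
`JX`-holomorphic curves (`jHolomorphic_uniqueContinuation_const`, McDuff 1991, Lemma 2.3). With
`Σ` embedded as above, if `u` takes all its values in `Σ` and is not constant then
`range u ∪ {v 0} = Σ`: the image is relatively open in `Σ` (the nested alternative of
`twoChart_isolated_or_nested` at every parameter, also for `v` at `0`), compact, and `Σ` is
connected. [cite: Wendl2018, Thm. 2.49] [cite: McDuff1991LocalBehaviour, Lemma 2.7 and Lemma 2.3] -/
theorem twoChart_range_union_eq_of_forall_mem (hUC : jHolomorphic_uniqueContinuation_const)
    (JX : AlmostComplexStructure (𝓡 4) ∞ X)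
    {u₀ v₀ : ℂ → X} (hu₀ : ContMDiff 𝓘(ℝ, ℂ) (𝓡 4) ∞ u₀)
    (hv₀ : ContMDiff 𝓘(ℝ, ℂ) (𝓡 4) ∞ v₀) (huv₀ : ∀ z : ℂ, z ≠ 0 → v₀ z = u₀ z⁻¹)
    (hJu₀ : IsJHolomorphic (𝓡 4) (fun y => JX y) u₀)
    (hJv₀ : IsJHolomorphic (𝓡 4) (fun y => JX y) v₀) (hinj : Injective u₀)
    (himm : ∀ z, Injective (mfderiv 𝓘(ℝ, ℂ) (𝓡 4) u₀ z))
    (himm₀ : Injective (mfderiv 𝓘(ℝ, ℂ) (𝓡 4) v₀ 0)) (hnot : v₀ 0 ∉ range u₀)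
    {u v : ℂ → X} (hu : ContMDiff 𝓘(ℝ, ℂ) (𝓡 4) ∞ u) (hv : ContMDiff 𝓘(ℝ, ℂ) (𝓡 4) ∞ v)
    (huv : ∀ z : ℂ, z ≠ 0 → v z = u z⁻¹) (hJu : IsJHolomorphic (𝓡 4) (fun y => JX y) u)
    (hJv : IsJHolomorphic (𝓡 4) (fun y => JX y) v)
    (hsub : ∀ z, u z ∈ range u₀ ∪ {v₀ 0}) (hnc : ∃ z, u z ≠ u 0) :
    range u ∪ {v 0} = range u₀ ∪ {v₀ 0} := by
  set T : Set X := range u₀ ∪ {v₀ 0} with hT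
  have hTc : IsClosed T := (isCompact_twoChart_range_union hu₀.continuous hv₀.continuous huv₀).isClosed
  have hvsub : ∀ w, v w ∈ T := twoChart_snd_mem_of_fst_mem hv.continuous huv hTc hsub
  set R : Set X := range u ∪ {v 0} with hR
  have hRT : R ⊆ T := by
    rintro _ (⟨z, rfl⟩ | rfl)
    · exact hsub z
    · exact hvsub 0
  -- unique continuation: `u` and `v` are nowhere locally constant
  have hJ2 : ∀ (x : X) (w : TangentSpace (𝓡 4) x), JX x (JX x w) = -w := fun x w => JX.map_map x w
  have hu_nlc : ∀ z₀, ∃ᶠ z in 𝓝 z₀, u z ≠ u z₀ := fun z₀ => by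
    refine Filter.not_eventually.1 fun h => ?_
    have hall := hUC X (fun x => JX x) hJ2 (fun x₀ => JX.contMDiffAt_inTangentCoordinates x₀)
      u hu hJu z₀ h
    obtain ⟨z, hz⟩ := hnc
    exact hz (by rw [hall z, hall 0])
  have hvnc : ∃ w, v w ≠ v 0 := by
    by_contra h
    have h' : ∀ w, v w = v 0 := fun w => by_contra fun hw => h ⟨w, hw⟩
    have hvu : ∀ z : ℂ, z ≠ 0 → u z = v z⁻¹ := fun z hz => by
      rw [huv _ (inv_ne_zero hz), inv_inv]
    have hall := twoChart_snd_eq_of_fst_eq hu.continuous hvu h'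
    obtain ⟨z, hz⟩ := hnc
    exact hz (by rw [hall z, hall 0])
  have hv_nlc : ∀ w₀, ∃ᶠ w in 𝓝 w₀, v w ≠ v w₀ := fun w₀ => by
    refine Filter.not_eventually.1 fun h => ?_
    have hall := hUC X (fun x => JX x) hJ2 (fun x₀ => JX.contMDiffAt_inTangentCoordinates x₀)
      v hv hJv w₀ h
    obtain ⟨w, hw⟩ := hvnc
    exact hw (by rw [hall w, hall 0])
  -- the image is relatively open in `T`
  have hopen_pt : ∀ p ∈ R, ∃ O ∈ 𝓝 p, O ∩ T ⊆ R := by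
    rintro p (⟨z₀, rfl⟩ | rfl)
    · rcases twoChart_isolated_or_nested hu₀ hv₀ huv₀ hJu₀ hJv₀ hinj himm himm₀ hnot hu hJu
          (hsub z₀) (hu_nlc z₀) with h | ⟨-, h⟩
      · exfalso
        obtain ⟨z, hz⟩ := (h.and self_mem_nhdsWithin).exists
        exact hz.1 (hsub z)
      · obtain ⟨O, hO, hOT⟩ := h 1 one_pos
        exact ⟨O, hO, hOT.trans ((image_subset_range _ _).trans subset_union_left)⟩
    · rcases twoChart_isolated_or_nested hu₀ hv₀ huv₀ hJu₀ hJv₀ hinj himm himm₀ hnot hv hJv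
          (hvsub 0) (hv_nlc 0) with h | ⟨-, h⟩
      · exfalso
        obtain ⟨w, hw⟩ := (h.and self_mem_nhdsWithin).exists
        exact hw.1 (hvsub w)
      · obtain ⟨O, hO, hOT⟩ := h 1 one_pos
        refine ⟨O, hO, hOT.trans ?_⟩
        rintro _ ⟨s, -, rfl⟩
        exact twoChart_range_snd_subset huv ⟨s, rfl⟩
  set O : Set X := interior (Tᶜ ∪ R) with hO
  have hRO : R ⊆ O := fun p hp => by
    obtain ⟨O', hO', hsub'⟩ := hopen_pt p hp
    refine mem_interior_iff_mem_nhds.2 (mem_of_superset hO' fun x hx => ?_)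
    by_cases hxT : x ∈ T
    · exact Or.inr (hsub' ⟨hx, hxT⟩)
    · exact Or.inl hxT
  have hOT : T ∩ O ⊆ R := fun x ⟨hxT, hxO⟩ =>
    (interior_subset hxO).elim (fun h => absurd hxT h) id
  have hRc : IsClosed R := (isCompact_twoChart_range_union hu.continuous hv.continuous huv).isClosed
  have hpre : IsPreconnected T := isPreconnected_twoChart_range_union hu₀.continuous hv₀.continuous huv₀
  refine Subset.antisymm hRT fun x hxT => ?_
  by_contra hxR
  have hcov : T ⊆ O ∪ Rᶜ := fun y hy => by
    by_cases hyR : y ∈ R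
    · exact Or.inl (hRO hyR)
    · exact Or.inr hyR
  obtain ⟨y, hyT, hyO, hyR⟩ := hpre O Rᶜ isOpen_interior hRc.isOpen_compl hcov
    ⟨u 0, hsub 0, hRO (Or.inl ⟨0, rfl⟩)⟩ ⟨x, hxT, hxR⟩
  exact hyR (hOT ⟨hyT, hyO⟩)

/-- **Wendl 2018, Thm. 2.49 (first assertion) for an embedded sphere: finitely many
intersection parameters, or identical images.** In an almost complex 4-manifold, a
non-constant smooth `JX`-holomorphic two-chart sphere `(u, v)` and an embedded `JX`-holomorphic
two-chart sphere `Σ = range u₀ ∪ {v₀ 0}` either have the same image, or `u z ∈ Σ` for only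
finitely many `z` (assuming unique continuation `jHolomorphic_uniqueContinuation_const`, McDuff
1991, Lemma 2.3, used only to pass from "`u` lies in `Σ`" to "the images coincide").
[cite: Wendl2018, Thm. 2.49] [cite: McDuff1991LocalBehaviour, Lemma 2.7 and Lemma 2.3] -/
theorem twoChart_range_union_eq_or_finite (hUC : jHolomorphic_uniqueContinuation_const)
    (JX : AlmostComplexStructure (𝓡 4) ∞ X)
    {u₀ v₀ : ℂ → X} (hu₀ : ContMDiff 𝓘(ℝ, ℂ) (𝓡 4) ∞ u₀)
    (hv₀ : ContMDiff 𝓘(ℝ, ℂ) (𝓡 4) ∞ v₀) (huv₀ : ∀ z : ℂ, z ≠ 0 → v₀ z = u₀ z⁻¹)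
    (hJu₀ : IsJHolomorphic (𝓡 4) (fun y => JX y) u₀)
    (hJv₀ : IsJHolomorphic (𝓡 4) (fun y => JX y) v₀) (hinj : Injective u₀)
    (himm : ∀ z, Injective (mfderiv 𝓘(ℝ, ℂ) (𝓡 4) u₀ z))
    (himm₀ : Injective (mfderiv 𝓘(ℝ, ℂ) (𝓡 4) v₀ 0)) (hnot : v₀ 0 ∉ range u₀)
    {u v : ℂ → X} (hu : ContMDiff 𝓘(ℝ, ℂ) (𝓡 4) ∞ u) (hv : ContMDiff 𝓘(ℝ, ℂ) (𝓡 4) ∞ v)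
    (huv : ∀ z : ℂ, z ≠ 0 → v z = u z⁻¹) (hJu : IsJHolomorphic (𝓡 4) (fun y => JX y) u)
    (hJv : IsJHolomorphic (𝓡 4) (fun y => JX y) v) (hnc : ∃ z, u z ≠ u 0) :
    range u ∪ {v 0} = range u₀ ∪ {v₀ 0} ∨ {z : ℂ | u z ∈ range u₀ ∪ {v₀ 0}}.Finite := by
  rcases twoChart_preimage_eq_univ_or_finite JX hu₀ hv₀ huv₀ hJu₀ hJv₀ hinj himm himm₀ hnot hu hv
      huv hJu hJv with h | h
  · left
    exact twoChart_range_union_eq_of_forall_mem hUC JX hu₀ hv₀ huv₀ hJu₀ hJv₀ hinj himm himm₀ hnot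
      hu hv huv hJu hJv (fun z => (h.symm ▸ mem_univ z : z ∈ {z : ℂ | u z ∈ range u₀ ∪ {v₀ 0}})) hnc
  · exact Or.inr h

end Global

end Literature.Geometry.Symplectic

end
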